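import Literature.AnabelianGeometry.AbsoluteAnabelian.AbsTopILem27HSEdge
import Literature.AnabelianGeometry.AbsoluteAnabelian.AbsTopIThm26iiiClauseOneProofs
import Literature.NumberTheory.GaloisRepresentations.ContinuousCohomologyTransport
import Literature.NumberTheory.GaloisRepresentations.LocalFieldCdTwo
import HarnessLib

/-!
# [AbsTopI] Thm 2.6 (iii), proof p. 23: the Hochschild–Serre step at an MLF base — `δ²_l(H′) ≥ 1`
# from a compatible `E₂^{1,1}`-family ALONE

S. Mochizuki, *Topics in Absolute Anabelian Geometry I: Generalities* (2012) [AbsTopI], proof of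
Thm 2.6 (iii), p. 23: "Since `G` is of cohomological dimension 2 [...], and `δ²_l(G) = 0` for all
`l ∈ Primes` [cf., e.g., [NSW], Theorem 7.2.6], the spectral sequence associated to the surjection
`Π ↠ G` yields [...] injections [...] `↪ H²(Π, ℚ_l)` [...].  By applying the analogue of this conclusion
for an arbitrary open subgroup `H ⊆ Π` [...]".

`AbsTopILem27HSEdge.lean` proved the Hochschild–Serre step for an abstract profinite `Π ⊵ Δ` under
the two inputs «`m` kills `H²(Π/Δ, (ℤ/lⁱ)^Δ)`» and «`H³(Π/Δ, (ℤ/lⁱ)^Δ) = 0`».  This file DISCHARGES both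
inputs for an extension `1 → Δ → Π → G → 1` with MLF base data (`B : E.MLFBase`: `G ≅ G_K`, `K` a
finite extension of `ℚ_p`) and for EVERY open subgroup `J ≤ Π` (with `N := Δ ∩ J`, `J/N ≅ G_{K′}`,
`K′/K` finite — `exists_quotient_continuousMulEquiv_absoluteGaloisGroup`):

* `subsingleton_continuousCohomology_three_zmod_absoluteGaloisGroup` — `H³(G_K, ℤ/lⁱ) = 0`
  ("cohomological dimension 2": the tree's `fieldCdLE_two`, Serre II §4.3 Prop. 12);
* `exists_nsmul_two_and_subsingleton_three_quotientInvariants` — for open `J ≤ Π`: one `m > 0` kills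
  every `H²(J/N, (ℤ/lⁱ)^N)` ("`δ²_l(G) = 0`" at the finite levels: `#H²(G_{K′}, ℤ/lⁱ) ∣ m`,
  `exists_nsmul_continuousCohomology_two_zmod_eq_zero`) and `H³(J/N, (ℤ/lⁱ)^N) = 0`, transported
  from `G_{K′}` along `J/N ≃ₜ* G_{K′}` with the coefficient identification `(ℤ/lⁱ)^N ≅ ℤ/lⁱ`
  (`ContinuousCohomologyTransport`);
* **`one_le_deltaInv_two_of_hOneRep_family_of_isOpen`** — hence, for every open `J ≤ Π`, a family
  `z_i ∈ H¹(J/N, H¹(N, ℤ/lⁱ))` compatible under the reductions `ℤ/l^{i+1} → ℤ/lⁱ` and of UNBOUNDED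
  order (`∀ n ≥ 1, ∃ i, n • z_i ≠ 0`) gives `1 ≤ δ²_l(J)` — the conclusion `1 ≤ deltaInv H′ 2 l` of
  `FundamentalExtension.Lem27iiiStep` at `H′ = J`, with ONLY the `E₂^{1,1}`-family as input.

What produces the family is Lemma 2.7 (ii)(iii) for the Tate module of the Albanese (the geometric
`G`-module datum; GAP row G-w5d058g8-2 of the abc-iut cell) — not addressed here.  HONEST FRAMING:
refereed, undisputed paper; classical Galois cohomology; nothing here bears on [IUTchIII] Cor. 3.12.

## References
* S. Mochizuki, *Topics in Absolute Anabelian Geometry I* (2012), Thm 2.6 (iii), proof p. 23.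
  [MochizukiAbsTopI2012]
* J. Neukirch, A. Schmidt, K. Wingberg, *Cohomology of Number Fields*, 2nd ed. (2008), Thm. 7.2.6,
  (2.4.1). [NeukirchSchmidtWingberg2008]
* J.-P. Serre, *Galois Cohomology* (1997), II §4.3 Prop. 12. [SerreGaloisCohomology1997]
-/

noncomputable section

open CategoryTheory Function Topology

namespace Literature.AnabelianGeometry.AbsoluteAnabelian

open Literature.NumberTheory.GaloisRepresentations
open _root_.TopRep _root_.ContRepresentation _root_.ContinuousCohomology Field

/-! ### `H³(G_K, ℤ/lⁱ) = 0` -/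

/-- **`H³(G_K, ℤ/lⁱ) = 0`** for a finite extension `K` of `ℚ_p`, every prime `l` and every `i`
(trivial action): `cd_l(G_K) ≤ 2` (Serre II §4.3 Prop. 12, the tree's `fieldCdLE_two` at the
non-archimedean local field structure of `K`) and `ℤ/lⁱ` is `l`-primary torsion.
[cite: SerreGaloisCohomology1997, II §4.3 Prop. 12] [cite: MochizukiAbsTopI2012, Thm 2.6 (iii) proof p.23] -/
theorem subsingleton_continuousCohomology_three_zmod_absoluteGaloisGroup (p : ℕ) [Fact p.Prime]
    (K : Type) [Field K] [Algebra ℚ_[p] K] [FiniteDimensional ℚ_[p] K] (l : ℕ) [Fact l.Prime]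
    (i : ℕ) :
    Subsingleton (continuousCohomology 3
      (ContinuousRep.trivial (absoluteGaloisGroup K) ℤ (ZMod (l ^ i))).toTopRep) := by
  haveI : IsNonarchimedeanLocalField ℚ_[p] := Padic.isNonarchimedeanLocalField_holds p
  letI := FiniteExtension.valuativeRel ℚ_[p] K
  letI := FiniteExtension.topologicalSpace ℚ_[p] K
  haveI : IsNonarchimedeanLocalField K := FiniteExtension.isNonarchimedeanLocalField ℚ_[p] K
  haveI : CharZero K := charZero_of_injective_algebraMap (algebraMap ℚ_[p] K).injective
  have hl : IsPrimaryTorsion l (ZMod (l ^ i)) :=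
    IsPrimaryTorsion.of_forall_nsmul_eq_zero (r := i) fun m => by
      rw [nsmul_eq_mul, ZMod.natCast_self, zero_mul]
  exact subsingleton_continuousCohomology_of_two_lt (F := K) (p := l) _ hl (by norm_num)

namespace FundamentalExtension

variable (E : FundamentalExtension.{0})

/-! ### The two inputs of the edge at `J/(Δ ∩ J) ≅ G_{K′}` -/

/-- **The two inputs of the Hochschild–Serre edge, discharged at an MLF base.**  For `G ≅ G_K`
(`B : E.MLFBase`), an open subgroup `J ≤ Π` and `N := Δ ∩ J`: there is `m > 0` such that for every
`i`, `m` kills `H²(J/N, (ℤ/lⁱ)^N)` and `H³(J/N, (ℤ/lⁱ)^N) = 0` — transported from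
`H²(G_{K′}, ℤ/lⁱ)` (uniformly killed, "`δ²_l(G) = 0`") and `H³(G_{K′}, ℤ/lⁱ) = 0` ("cd 2") along
`J/N ≃ₜ* G_{K′}` and the coefficient identification `(ℤ/lⁱ)^N = ℤ/lⁱ` (all of `ℤ/lⁱ` is `N`-invariant,
both actions trivial). [cite: MochizukiAbsTopI2012, Thm 2.6 (iii) proof p.23]
[cite: NeukirchSchmidtWingberg2008, Thm. 7.2.6] -/
theorem exists_nsmul_two_and_subsingleton_three_quotientInvariants (B : E.MLFBase)
    {J : Subgroup E.arith} (hJ : IsOpen (J : Set E.arith)) (l : ℕ) [Fact l.Prime] :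
    ∃ m : ℕ, 0 < m ∧ ∀ i : ℕ,
      (∀ w : continuousCohomology 2 (((ContinuousRep.trivial ↥J ℤ (ZMod (l ^ i))).quotientInvariants
        (E.geom.subgroupOf J))).toTopRep, m • w = 0) ∧
      Subsingleton (continuousCohomology 3 (((ContinuousRep.trivial ↥J ℤ (ZMod (l ^ i))).quotientInvariants
        (E.geom.subgroupOf J))).toTopRep) := by
  classical
  haveI : (E.geom.subgroupOf J).Normal := E.normal_geom.subgroupOf J
  -- `J/(Δ ∩ J) ≅ G_{K'}`, `K'/K/ℚ_p` finite
  obtain ⟨K', hfinK', ⟨e⟩⟩ := E.exists_quotient_continuousMulEquiv_absoluteGaloisGroup B hJ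
  haveI := hfinK'
  haveI : FiniteDimensional ℚ_[B.p] ↥K' := FiniteDimensional.trans ℚ_[B.p] B.K ↥K'
  obtain ⟨m, hm0, hm⟩ := exists_nsmul_continuousCohomology_two_zmod_eq_zero B.p ↥K' l
  refine ⟨m, hm0, fun i => ?_⟩
  -- the correspondence of coefficients `(ℤ/lⁱ)^N ↔ ℤ/lⁱ` under `e`
  let ρ := ContinuousRep.trivial ↥J ℤ (ZMod (l ^ i))
  let τ := ρ.quotientInvariants (E.geom.subgroupOf J)
  let Y := (ContinuousRep.trivial (absoluteGaloisGroup ↥K') ℤ (ZMod (l ^ i))).toTopRep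
  have hτ : ∀ (q : ↥J ⧸ E.geom.subgroupOf J) (v : ρ.invariantsOf (E.geom.subgroupOf J)),
      ((τ q v : ρ.invariantsOf (E.geom.subgroupOf J)) : ZMod (l ^ i)) = v := by
    intro q v
    obtain ⟨σ, rfl⟩ := QuotientGroup.mk_surjective q
    exact ContinuousRep.quotientInvariants_apply_coe (E.geom.subgroupOf J) ρ σ v
  let φ : TopRep.res ((e.symm : absoluteGaloisGroup ↥K' →ₜ* (↥J ⧸ E.geom.subgroupOf J)) :
      absoluteGaloisGroup ↥K' →* (↥J ⧸ E.geom.subgroupOf J)) τ.toTopRep ⟶ Y :=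
    TopRep.ofHom
      ⟨{ toLinearMap := (ρ.invariantsOf (E.geom.subgroupOf J)).subtype
         cont := continuous_subtype_val }, fun g => by
        refine ContinuousLinearMap.ext fun v => ?_
        exact hτ _ v⟩
  let ψ : TopRep.res ((e : (↥J ⧸ E.geom.subgroupOf J) →ₜ* absoluteGaloisGroup ↥K') :
      (↥J ⧸ E.geom.subgroupOf J) →* absoluteGaloisGroup ↥K') Y ⟶ τ.toTopRep :=
    TopRep.ofHom
      ⟨{ toFun := fun a => ⟨a, fun _ => rfl⟩
         map_add' := fun _ _ => rfl
         map_smul' := fun _ _ => rfl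
         cont := continuous_of_discreteTopology }, fun g => by
        refine ContinuousLinearMap.ext fun a => Subtype.ext ?_
        exact (hτ _ _).symm⟩
  have hψφ : ∀ v : τ.toTopRep, ψ.hom (φ.hom v) = v := fun v => Subtype.ext rfl
  refine ⟨fun w => nsmul_continuousCohomology_eq_zero_of_continuousMulEquiv e φ ψ hψφ 2 (hm i) w, ?_⟩
  haveI := subsingleton_continuousCohomology_three_zmod_absoluteGaloisGroup B.p ↥K' l i
  exact subsingleton_continuousCohomology_of_continuousMulEquiv e φ ψ hψφ 3

/-! ### `δ²_l(J) ≥ 1` from a compatible `E₂^{1,1}`-family, for every open `J ≤ Π` -/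

/-- **[AbsTopI] Thm 2.6 (iii), proof p. 23 — the Hochschild–Serre step, all its inputs discharged
at an MLF base.**  For an extension `1 → Δ → Π → G → 1` with `G ≅ G_K`, `K` a finite extension of
`ℚ_p` (`B : E.MLFBase`), an open subgroup `J ≤ Π` with `N := Δ ∩ J`, and a prime `l`: every family
`z_i ∈ H¹(J/N, H¹(N, ℤ/lⁱ))` (`i ≥ 0`; `hOneRep` = `H¹(N, –)` with the conjugation action) which is
COMPATIBLE under the reductions `ℤ/l^{i+1} → ℤ/lⁱ` and of UNBOUNDED order (`∀ n ≥ 1, ∃ i, n • z_i ≠ 0`,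
e.g. `z_i` of exact order `lⁱ`) forces `dim_{ℚ_l} H²_cont(J, ℚ_l) ≥ 1`, i.e. **`1 ≤ deltaInv J 2 l`**
— the conclusion of `FundamentalExtension.Lem27iiiStep` at `H′ = J`.  ("`cd G = 2`, `δ²_l(G) = 0`
⟹ `H¹(G, H¹(Δ, –)) ↪ H²(Π, –)` … `δ²_l(Π) ≥ 1`", applied "for an arbitrary open subgroup `H ⊆ Π`".)
The three instance arguments are supplied by the caller as
`isCompact_iff_compactSpace.1 (Subgroup.isClosed_of_isOpen J hJ).isCompact`,
`E.normal_geom.subgroupOf J`, `E.isClosed_geom.preimage continuous_subtype_val`.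
[cite: MochizukiAbsTopI2012, Thm 2.6 (iii) proof p.23] [cite: NeukirchSchmidtWingberg2008, (2.4.1)] -/
theorem one_le_deltaInv_two_of_hOneRep_family_of_isOpen (B : E.MLFBase) {J : Subgroup E.arith}
    (hJ : IsOpen (J : Set E.arith)) (l : ℕ) [Fact l.Prime]
    [CompactSpace ↥J] [(E.geom.subgroupOf J).Normal]
    [IsClosed ((E.geom.subgroupOf J : Subgroup ↥J) : Set ↥J)]
    (z : ∀ i : ℕ, continuousCohomology 1
      (hOneRep (E.geom.subgroupOf J) (zmodTrivRep (P := ↥J) l i)).toTopRep)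
    (hz : ∀ i, cohomologyMap (hOneRepMap (E.geom.subgroupOf J) (zmodTr ↥J l i)) 1 (z (i + 1)) = z i)
    (hord : ∀ n : ℕ, 0 < n → ∃ i, n • z i ≠ 0) :
    1 ≤ deltaInv ↥J 2 l := by
  obtain ⟨m, hm0, hm⟩ := E.exists_nsmul_two_and_subsingleton_three_quotientInvariants B hJ l
  haveI : ∀ i : ℕ, Subsingleton (continuousCohomology 3
      ((zmodTrivRep (P := ↥J) l i).quotientInvariants (E.geom.subgroupOf J)).toTopRep) :=
    fun i => (hm i).2
  exact one_le_deltaInv_two_of_hOneRep_family (E.geom.subgroupOf J) l m (fun i x => (hm i).1 x) z hz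
    fun n hn => hord (m * n) (Nat.mul_pos hm0 hn)

end FundamentalExtension

end Literature.AnabelianGeometry.AbsoluteAnabelian

end
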